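import Summits.BirchSwinnertonDyer.BirchSwinnertonDyer.Theses.AdditiveBranchIMC
import HarnessLib

/-!
# Route `AdditiveBranchIMC` (rung K1, cell `bsd-addord`): the parity glue `GordTwoRankZeroOffCaseOneGlue` PROVED

Item `stmt-BirchSwinnertonDyer-19246` of route `route-BirchSwinnertonDyer-AdditiveBranchIMC`
(`Theses/AdditiveBranchIMC.lean`, support, rank 203): the glue of the parity split (gen 1) of the
deciding crux `GordTwoRankZeroOffCaseOne` (item 19357) into its even half
`GordTwoRankZeroOffCaseOneEven` (`p ≡ 1 (mod 4)`, item 19244) and its odd half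
`GordTwoRankZeroOffCaseOneOdd` (`p ≡ 3 (mod 4)`, item 19245).  The glue
`GordTwoRankZeroOffCaseOneEven → GordTwoRankZeroOffCaseOneOdd → GordTwoRankZeroOffCaseOne` is pure
logic: the cell hypothesis `N10.CellGordTwo W p` carries `p ≠ 2` as its first component, an odd prime
is `≡ 1` or `≡ 3 (mod 4)`, and each residue class is one child.  This is the planner's sketch
(`Cruxes/…/split19357/SketchSplit.lean`, `gordTwoRankZeroOffCaseOne_of_even_of_odd`) landed verbatim
against the glue item; the converse direction (parent ⇒ both children) is recorded in the same file,
so the split is certified lossless: `GordTwoRankZeroOffCaseOne ↔ (Even ∧ Odd)`.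

Nothing is assumed: no named fact, no hypothesis beyond the item's own statement.
-/

set_option autoImplicit false
set_option linter.dupNamespace false

namespace Summit.BirchSwinnertonDyer.BirchSwinnertonDyer.Theorems

open Summit.BirchSwinnertonDyer.BirchSwinnertonDyer.Theses.AdditiveBranchIMC in
/-- **Item `GordTwoRankZeroOffCaseOneGlue` of route `AdditiveBranchIMC` holds**: the even-branch half
(`p ≡ 1 (mod 4)`) and the odd-branch half (`p ≡ 3 (mod 4)`) of the crux `GordTwoRankZeroOffCaseOne`
together give the crux, because `N10.CellGordTwo W p` forces `p ≠ 2` and an odd prime is `≡ 1` or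
`≡ 3 (mod 4)`. -/
theorem additiveBranchIMC_gordTwoRankZeroOffCaseOneGlue_proof :
    Summit.BirchSwinnertonDyer.BirchSwinnertonDyer.Theses.AdditiveBranchIMC.GordTwoRankZeroOffCaseOneGlue := by
  unfold GordTwoRankZeroOffCaseOneGlue GordTwoRankZeroOffCaseOneEven GordTwoRankZeroOffCaseOneOdd
    GordTwoRankZeroOffCaseOne
  intro hEven hOdd W _ _ p _ hr hc hno
  have h4 : p % 4 = 1 ∨ p % 4 = 3 := by
    have := Nat.odd_iff.mp ((Fact.out : p.Prime).odd_of_ne_two hc.1)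
    omega
  rcases h4 with h1 | h3
  · exact hEven W p hr hc hno h1
  · exact hOdd W p hr hc hno h3

open Summit.BirchSwinnertonDyer.BirchSwinnertonDyer.Theses.AdditiveBranchIMC in
/-- The parity split of crux `GordTwoRankZeroOffCaseOne` is lossless: the parent is equivalent to
the conjunction of its two children (parent ⇒ child: drop the parity hypothesis; children ⇒ parent:
the glue `additiveBranchIMC_gordTwoRankZeroOffCaseOneGlue_proof`). -/
theorem additiveBranchIMC_gordTwoRankZeroOffCaseOne_iff_even_and_odd :
    GordTwoRankZeroOffCaseOne ↔ (GordTwoRankZeroOffCaseOneEven ∧ GordTwoRankZeroOffCaseOneOdd) :=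
  ⟨fun h => ⟨fun W _ _ p _ hr hc hno _ => h W p hr hc hno, fun W _ _ p _ hr hc hno _ => h W p hr hc hno⟩,
    fun h => additiveBranchIMC_gordTwoRankZeroOffCaseOneGlue_proof h.1 h.2⟩

end Summit.BirchSwinnertonDyer.BirchSwinnertonDyer.Theorems
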